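import Summits.ABC.ABC.Theses.DefiniteXi
import Summits.ABC.ABC.Theorems.IsogenyGlueCongruenceMazurKenkuBoundOfEightTables
import Literature.NumberTheory.EllipticCurves.PastenHeightBoundsLemma68LocalProofs
import Literature.NumberTheory.EllipticCurves.OpenImageMazurInputs
import HarnessLib

/-!
# Stub ideas k3 (gen 14, FAMILY 3 — probe the extremes) — `stub_pastenLemma68 : PastenShimura2024_lemma_6_8`
(crux `DefiniteRTControlPrime`, stmt-ABC-11338, route `DefiniteXi`; registered skeleton `Lines/Sketch.lean`).
Companion of `STUB-IDEAS-stub_pastenLemma68-3.md` (gen 14).  `lean check`: sorries ONLY in the helper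
stubs `stubO2`, `stubO4`, `stubO5`, `stubT3`, `stubT5` (signatures for the stub prover, one cycle each).

EXTREMAL PLACE SPLIT.  The stub quantifies over a multiplicative place `v` of `W`.
* ODD `v` (§B): Mazur's Cor. 4.4 ALONE (`h44`, no `j`-table, no Thm. 1) kills every prime `ℓ = 11`
  or `ℓ ≥ 17` dividing a cyclic degree out of `W`; the eleven levels
  `{15,20,21,27,32} (tree theorems) ∪ {26,35,49,65,125,169} (hL6)` then bound every cyclic degree out
  of `W` by `144` (certified: `oddBarrier_covers`, `decide`), so Lemma 6.8 holds at odd places with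
  constant `144` from `h44 + hL6` — the `j`-tables `hT8` of the radius are NOT needed.
* `v = 2` (§C): Cor. 4.4 is silent (`e < p − 1` fails at `p = 2`); the residual class is
  `j ∈ ℤ[1/2] ∖ ℤ`.  The Tate module at `2` (`TateLineFrobeniusSq`, Silverman ATAEC V.5.3/5.4/6.1)
  forces `2^{12k} ≡ 1` or `2^{12}` (mod `N`) on Mazur's exponent `k`, which kills the classes
  `k ≡ 1/2, 1/3, 2/3` unless `N = 17` (`twoAdic_class_filter`, PROVED), leaving `N ∈ {13, 37} ∪ {17}`:
  rows `11, 19, 43, 67, 163` of `hT8` become unnecessary; rows `17, 37` remain.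
* Plan A (verbatim, one line, PROVED modulo the radius inputs): `stub_of_eight`.
-/

noncomputable section

set_option linter.dupNamespace false

open scoped Classical
open NumberField IsDedekindDomain IsDedekindDomain.HeightOneSpectrum Field WeierstrassCurve
open Literature.NumberTheory.EllipticCurves Literature.NumberTheory.EllipticCurves.ModularForms
open Literature.NumberTheory.GaloisRepresentations
open Summit.ABC.ABC.Theorems

namespace Summit.ABC.ABC.Cruxes.DefiniteRTControlPrime.StubIdeas3G14

/-! ## §A  Plan A (verbatim) and the place split -/

/-- **L0 (PROVED).** Radius `163` (item stmt-ABC-15193, `RibetTakahashiSplit.MazurKenkuRadius`) ⇒ the stub: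
cyclic companion + Tate/modular-polynomial transport `c_v(W)·b = c_v(W')·a`, `ab ∣ deg`. [cite: PastenShimura2024, Lemma 6.8] -/
theorem stub_of_radius (hR : Summit.ABC.ABC.Theses.RibetTakahashiSplit.MazurKenkuRadius) :
    PastenShimura2024_lemma_6_8 := by
  intro W W' _ _ hiso v hv
  obtain ⟨φ, hB⟩ := hR W W' hiso
  have hv' : W'.HasMultiplicativeReductionAt v := hasMultiplicativeReductionAt_of_isIsogenous ⟨φ⟩ v hv
  obtain ⟨ψ, hcyc, hdvd⟩ := φ.exists_isCyclic_degree_dvd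
  obtain ⟨a, b, ha, hb, hab, h⟩ :=
    exists_ordMinimalDiscriminant_mul_eq_mul_of_isCyclic ψ.degree ψ hcyc rfl v hv hv'
  have habn : a * b ≤ 163 := (Nat.le_of_dvd φ.degree_pos (hab.trans hdvd)).trans hB
  refine ⟨a, b, ha, ?_, hb, ?_, h⟩
  · have : a ≤ a * b := Nat.le_mul_of_pos_right a hb
    omega
  · have : b ≤ a * b := Nat.le_mul_of_pos_left b ha
    omega

/-- **Plan A, closed form (PROVED modulo the printed inputs of the radius, cycle 24):**
Cor. 4.4 (`h44`, item stmt-ABC-18223), the eight `j`-tables (`hT8`), the six smooth levels (`hL6`);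
`hK7` (Klein–Fricke at `7`) is DISCHARGED in the tree (`stub_kleinSevenRat`,
`IsogenyGlueCongruenceMazurKenkuBoundLevelTwentyOne`, whence `mazurKenkuRadius_of_three h44 hT8 hL6`).
[cite: Mazur1978, Cor. 4.4 and Thm. 1] [cite: Kenku1982, Thm. 1] -/
theorem stub_of_eight (h44 : Mazur1978.cor44_valuation_j_le_one)
    (hT8 : ∀ (V V' : WeierstrassCurve ℚ) [V.IsElliptic] [V'.IsElliptic] (ψ : Isogeny V V'),
      ψ.IsCyclic → ψ.degree ∈ ({11, 17, 19, 27, 37, 43, 67, 163} : Finset ℕ) →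
        (ψ.degree, V.j) ∈ kenkuIsogenyJTable)
    (hL6 : ∀ (V V' : WeierstrassCurve ℚ) [V.IsElliptic] [V'.IsElliptic] (ψ : Isogeny V V'),
      ψ.IsCyclic → ψ.degree ∉ ({26, 35, 49, 65, 125, 169} : Finset ℕ))
    (hK7 : ∀ (W W' : WeierstrassCurve ℚ) [W.IsElliptic] (φ : Isogeny W W'), φ.degree = 7 →
      ∃ t : ℚ, t ≠ 0 ∧ W.j = (t ^ 2 + 13 * t + 49) * (t ^ 2 + 5 * t + 1) ^ 3 / t) :
    PastenShimura2024_lemma_6_8 :=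
  stub_of_radius (mazurKenkuRadius_of_eight h44 hT8 hL6 hK7)

/-- Lemma 6.8 with constant `B` at the ODD multiplicative places. -/
def Lemma68Odd (B : ℕ) : Prop :=
  ∀ (W W' : WeierstrassCurve ℚ) [W.IsElliptic] [W'.IsElliptic], W.IsIsogenous W' →
    ∀ v : HeightOneSpectrum ℤ, (2 : ℤ) ∉ v.asIdeal → W.HasMultiplicativeReductionAt v →
      ∃ m n : ℕ, 0 < m ∧ m ≤ B ∧ 0 < n ∧ n ≤ B ∧
        W.ordMinimalDiscriminant v * n = W'.ordMinimalDiscriminant v * m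

/-- Lemma 6.8 with constant `B` at the place `2`. -/
def Lemma68AtTwo (B : ℕ) : Prop :=
  ∀ (W W' : WeierstrassCurve ℚ) [W.IsElliptic] [W'.IsElliptic], W.IsIsogenous W' →
    ∀ v : HeightOneSpectrum ℤ, (2 : ℤ) ∈ v.asIdeal → W.HasMultiplicativeReductionAt v →
      ∃ m n : ℕ, 0 < m ∧ m ≤ B ∧ 0 < n ∧ n ≤ B ∧
        W.ordMinimalDiscriminant v * n = W'.ordMinimalDiscriminant v * m

/-- **S1 (PROVED).** The stub is the conjunction of its two extremes. -/
theorem stub_of_split (ho : Lemma68Odd 163) (ht : Lemma68AtTwo 163) : PastenShimura2024_lemma_6_8 := by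
  intro W W' _ _ hiso v hv
  by_cases h2 : (2 : ℤ) ∈ v.asIdeal
  · exact ht W W' hiso v h2 hv
  · exact ho W W' hiso v h2 hv

theorem lemma68Odd_mono {B B' : ℕ} (hBB : B ≤ B') (h : Lemma68Odd B) : Lemma68Odd B' := by
  intro W W' _ _ hiso v h2 hv
  obtain ⟨m, n, hm, hmB, hn, hnB, e⟩ := h W W' hiso v h2 hv
  exact ⟨m, n, hm, hmB.trans hBB, hn, hnB.trans hBB, e⟩

/-! ## §B  The odd half: `h44 + hL6` only (no `j`-tables) -/

/-- Cyclic-degree radius `K` out of any curve with an ODD multiplicative place. -/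
def OddSourceRadius (K : ℕ) : Prop :=
  ∀ (W W'' : WeierstrassCurve ℚ) [W.IsElliptic] [W''.IsElliptic] (ψ : Isogeny W W''), ψ.IsCyclic →
    (∃ v : HeightOneSpectrum ℤ, (2 : ℤ) ∉ v.asIdeal ∧ W.HasMultiplicativeReductionAt v) → ψ.degree ≤ K

/-- **O1 (PROVED).** Source radius `K` on the odd-multiplicative locus ⇒ `Lemma68Odd K` (transport as in L0). -/
theorem lemma68Odd_of_oddSourceRadius (K : ℕ) (h : OddSourceRadius K) : Lemma68Odd K := by
  intro W W' _ _ hiso v h2 hv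
  obtain ⟨φ⟩ := hiso
  have hv' : W'.HasMultiplicativeReductionAt v := hasMultiplicativeReductionAt_of_isIsogenous ⟨φ⟩ v hv
  obtain ⟨ψ, hcyc, -⟩ := φ.exists_isCyclic_degree_dvd
  have hK : ψ.degree ≤ K := h W W' ψ hcyc ⟨v, h2, hv⟩
  obtain ⟨a, b, ha, hb, hab, e⟩ :=
    exists_ordMinimalDiscriminant_mul_eq_mul_of_isCyclic ψ.degree ψ hcyc rfl v hv hv'
  have habn : a * b ≤ K := (Nat.le_of_dvd ψ.degree_pos hab).trans hK
  refine ⟨a, b, ha, ?_, hb, ?_, e⟩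
  · have : a ≤ a * b := Nat.le_mul_of_pos_right a hb
    omega
  · have : b ≤ a * b := Nat.le_mul_of_pos_left b ha
    omega

/-- The eleven excluded levels at an odd multiplicative place: `15, 21, 27` (tabulated `j` lies in
`ℤ[1/2]`: tree theorems `levelFifteen_jTable`, `levelTwentyOne_jTable`,
`Isogeny.j_eq_of_isCyclic_degree_twentySeven`), `20, 32` (tree: no cyclic isogeny at all), and the six
smooth levels `hL6`.  Certified minimal for the bound `144` (`level_budget2.py`: dropping `15 → 450`,
`21 → 1008`, `26 → 2275`, `35 → 350`, `65 → 325`, `49/125/169 → ∞`). -/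
def oddBarrier : Finset ℕ := {15, 20, 21, 26, 27, 32, 35, 49, 65, 125, 169}

/-- **O3 (PROVED, `decide`).** Coverage: every `{2,3,5,7,13}`-smooth `d ∈ (144, 144²]` (tested as
`d ∣ 2730¹⁵`) has a divisor in `oddBarrier`; hence the divisor-closed set of admissible cyclic degrees
is `{1,…,10,12,13,14,16,18,24,25,28,36,39,48,50,56,72,91,112,117,144}`, max `144 ≤ 163`. [folklore] -/
theorem oddBarrier_covers_core :
    ∀ d ∈ Finset.Ioc 144 (144 * 144), (2730 ^ 15) % d = 0 → ∃ b ∈ oddBarrier, b ∣ d := by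
  decide +kernel

/-- **O2 (stub for the prover, size M).** Cor. 4.4 place-wise over `ℤ`: a prime `ℓ ∉ {2,3,5,7,13}`
(so `ℓ = 11 ∨ 17 ≤ ℓ`) dividing a cyclic degree out of `W` gives a `Γ_ℚ`-stable line of order `ℓ`
(`ker ψ ∩ E[ℓ]`, as in `mem_mazurPrimes_of_prime_dvd_degree`), so `h44` makes `j(W)` integral at every
odd place — contradicting `one_lt_valuation_j_of_hasMultiplicativeReductionAt` (bridge the `ℤ`- and
`𝓞 ℚ`-indexed valuations via `HeightOneSpectrum.valuation_equiv_padicValuation`).  NO Thm. 1, NO table.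
[cite: Mazur1978, Cor. 4.4 (p. 145)] -/
theorem stubO2 (h44 : Mazur1978.cor44_valuation_j_le_one) :
    ∀ (W W'' : WeierstrassCurve ℚ) [W.IsElliptic] [W''.IsElliptic] (ψ : Isogeny W W''), ψ.IsCyclic →
      (∃ v : HeightOneSpectrum ℤ, (2 : ℤ) ∉ v.asIdeal ∧ W.HasMultiplicativeReductionAt v) →
        ∀ p : ℕ, p.Prime → p ∣ ψ.degree → p ∈ ({2, 3, 5, 7, 13} : Finset ℕ) := by
  sorry

/-- **O4 (stub for the prover, size M⁻).** The eleven levels are excluded out of a curve with an odd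
multiplicative place: `hL6`; `isogeny_isCyclic_degree_ne_twenty_holds`, `isogeny_isCyclic_degree_ne_thirtyTwo`;
and for `15, 21, 27` the tree's tables put `j(W)` in `ℤ[1/2]` (eight rationals with 2-power
denominators, one integer), so `v(j) ≤ 1` at odd `v`, against `one_lt_valuation_j_of_hasMultiplicativeReductionAt`.
[cite: Kenku1982, proof of Thm. 1, pp. 200–201] -/
theorem stubO4 (hL6 : ∀ (V V' : WeierstrassCurve ℚ) [V.IsElliptic] [V'.IsElliptic] (ψ : Isogeny V V'),
      ψ.IsCyclic → ψ.degree ∉ ({26, 35, 49, 65, 125, 169} : Finset ℕ)) :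
    ∀ (W W'' : WeierstrassCurve ℚ) [W.IsElliptic] [W''.IsElliptic] (ψ : Isogeny W W''), ψ.IsCyclic →
      (∃ v : HeightOneSpectrum ℤ, (2 : ℤ) ∉ v.asIdeal ∧ W.HasMultiplicativeReductionAt v) →
        ψ.degree ∉ oddBarrier := by
  sorry

/-- **O5 (stub for the prover, size S⁺).** Peeling, verbatim the landed `stub_radius_of_mazur_of_barrier`
with `(163, mazurPrimes)` replaced by `(144, {2,3,5,7,13})` and the exclusion RELATIVISED to the source
`W` (that proof only ever excludes cyclic sub-isogenies out of `W`, `Isogeny.exists_isCyclic_degree_eq_of_dvd`):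
a cyclic degree `n > 144` has a least divisor `d ∈ (144, 144²]` (all primes `≤ 13`), `O3` gives
`b ∈ oddBarrier`, `b ∣ d ∣ n`, and the cyclic sub-isogeny of degree `b` out of `W` contradicts `O4`. [folklore] -/
theorem stubO5
    (hO2 : ∀ (W W'' : WeierstrassCurve ℚ) [W.IsElliptic] [W''.IsElliptic] (ψ : Isogeny W W''), ψ.IsCyclic →
      (∃ v : HeightOneSpectrum ℤ, (2 : ℤ) ∉ v.asIdeal ∧ W.HasMultiplicativeReductionAt v) →
        ∀ p : ℕ, p.Prime → p ∣ ψ.degree → p ∈ ({2, 3, 5, 7, 13} : Finset ℕ))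
    (hO4 : ∀ (W W'' : WeierstrassCurve ℚ) [W.IsElliptic] [W''.IsElliptic] (ψ : Isogeny W W''), ψ.IsCyclic →
      (∃ v : HeightOneSpectrum ℤ, (2 : ℤ) ∉ v.asIdeal ∧ W.HasMultiplicativeReductionAt v) →
        ψ.degree ∉ oddBarrier) :
    OddSourceRadius 144 := by
  sorry

/-- **The odd half, assembled (PROVED from O1–O5): `h44 + hL6 ⇒ Lemma68Odd 163`.** -/
theorem lemma68Odd_of_cor44_of_liteLevels6 (h44 : Mazur1978.cor44_valuation_j_le_one)
    (hL6 : ∀ (V V' : WeierstrassCurve ℚ) [V.IsElliptic] [V'.IsElliptic] (ψ : Isogeny V V'),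
      ψ.IsCyclic → ψ.degree ∉ ({26, 35, 49, 65, 125, 169} : Finset ℕ)) :
    Lemma68Odd 163 :=
  lemma68Odd_mono (by norm_num)
    (lemma68Odd_of_oddSourceRadius 144 (stubO5 (stubO2 h44) (stubO4 hL6)))

/-! ## §C  The place `2`: the Tate-module filter on Mazur's exponent classes -/

/-- **T1 — the Tate module at a potentially multiplicative place (named-fact shape; Silverman ATAEC
Thm. V.5.3, Cor. V.5.4, proof of Prop. V.6.1).** At a place `v ∣ p` with `ord_v j(W) < 0`, `E[N]`
(`N ≠ p` prime) is, as a `D_𝔓`-module, an extension of `δ` by `δ·χ̄_N` with `δ² = 1`; so the character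
`r` of any `Γ_ℚ`-stable line satisfies `r(φ)² ∈ {1, p²}` at every arithmetic Frobenius `φ` at `𝔓`.
[cite: SilvermanATAEC1994, Thm. V.5.3, Cor. V.5.4, Prop. V.6.1] -/
def TateLineFrobeniusSq : Prop :=
  ∀ (W : WeierstrassCurve ℚ) [W.IsElliptic] (N p : ℕ) [Fact N.Prime], p.Prime → p ≠ N →
    ∀ {P : geomTorsion W N}, P ≠ 0 → ∀ {r : absoluteGaloisGroup ℚ →* (ZMod N)ˣ},
    (∀ σ : absoluteGaloisGroup ℚ, σ • P = ((r σ : (ZMod N)ˣ) : ZMod N).val • P) →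
    ∀ v : HeightOneSpectrum (𝓞 ℚ), (p : 𝓞 ℚ) ∈ v.asIdeal → 1 < v.valuation ℚ W.j →
    ∀ 𝔓 ∈ v.primesAbove, ∀ φ : absoluteGaloisGroup ℚ, IsArithFrobAt (𝓞 ℚ) φ 𝔓 →
      ((r φ : (ZMod N)ˣ) : ZMod N) ^ 2 = 1 ∨ ((r φ : (ZMod N)ˣ) : ZMod N) ^ 2 = (p : ZMod N) ^ 2

/-- Arithmetic core of T2: `N ∣ a - b` from `(a : ZMod N) = b`. [folklore] -/
private theorem dvd_sub_of_natCast_eq {N a b : ℕ} (hba : b ≤ a) (h : ((a : ℕ) : ZMod N) = (b : ℕ)) :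
    N ∣ a - b := by
  have h0 : ((a - b : ℕ) : ZMod N) = 0 := by rw [Nat.cast_sub hba, h, sub_self]
  exact (ZMod.natCast_eq_zero_iff _ _).1 h0

/-- **T2 (PROVED) — the 2-adic class filter.** For a prime `N = 11` or `N ≥ 19`, Mazur's classes
`k ≡ 1/2, 1/3, 2/3 (mod (N−1)/2)` are incompatible with `2^{12k} ≡ 1` or `2^{12k} ≡ 2^{12} (mod N)`:
they force `2^{12k} ≡ 2⁶, 2⁴, 2⁸`, and `N ∣ 63, 4032, 15, 4080, 255` or `3840` means `N ∈ {2,3,5,7,17}`.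
[cite: Mazur1978, Prop. 5.1 (p. 150) and §7 (p. 154)] -/
theorem twoAdic_class_filter {N : ℕ} (hN : N.Prime) (hge : N = 11 ∨ 17 ≤ N) (h17 : N ≠ 17) {k : ℕ}
    (hk : 2 * k ≡ 1 [MOD (N - 1) / 2] ∨ 3 * k ≡ 1 [MOD (N - 1) / 2] ∨ 3 * k ≡ 2 [MOD (N - 1) / 2])
    (h2 : (2 : ZMod N) ^ (12 * k) = 1 ∨ (2 : ZMod N) ^ (12 * k) = 2 ^ 12) : False := by
  haveI : Fact N.Prime := ⟨hN⟩
  set m := (N - 1) / 2 with hm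
  have hodd : N % 2 = 1 := by
    rcases hN.eq_two_or_odd with h | h <;> omega
  have hm2 : 2 < m := by omega
  have h2m : 2 * m = N - 1 := by omega
  -- Fermat
  have h20 : (2 : ZMod N) ≠ 0 := by
    intro h
    have h' : ((2 : ℕ) : ZMod N) = 0 := by exact_mod_cast h
    rw [ZMod.natCast_eq_zero_iff] at h'
    have := Nat.le_of_dvd (by norm_num) h'
    omega
  have hF : (2 : ZMod N) ^ (N - 1) = 1 := ZMod.pow_card_sub_one_eq_one h20
  -- the residue `c ∈ {6, 4, 8}` of `12k` modulo `N - 1`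
  have key : ∃ c ∈ ({6, 4, 8} : Finset ℕ), ∃ s : ℕ, 12 * k = c + (2 * m) * s := by
    rcases hk with h | h | h
    · have h' : 2 * k % m = 1 := by
        have := h; unfold Nat.ModEq at this; rwa [Nat.mod_eq_of_lt (by omega : 1 < m)] at this
      refine ⟨6, by simp, 3 * (2 * k / m), ?_⟩
      have := Nat.div_add_mod (2 * k) m
      rw [h'] at this
      nlinarith [this]
    · have h' : 3 * k % m = 1 := by
        have := h; unfold Nat.ModEq at this; rwa [Nat.mod_eq_of_lt (by omega : 1 < m)] at this
      refine ⟨4, by simp, 2 * (3 * k / m), ?_⟩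
      have := Nat.div_add_mod (3 * k) m
      rw [h'] at this
      nlinarith [this]
    · have h' : 3 * k % m = 2 := by
        have := h; unfold Nat.ModEq at this; rwa [Nat.mod_eq_of_lt (by omega : 2 < m)] at this
      refine ⟨8, by simp, 2 * (3 * k / m), ?_⟩
      have := Nat.div_add_mod (3 * k) m
      rw [h'] at this
      nlinarith [this]
  obtain ⟨c, hc, s, hs⟩ := key
  have hpow : (2 : ZMod N) ^ (12 * k) = 2 ^ c := by
    rw [hs, pow_add, h2m, pow_mul, hF, one_pow, mul_one]
  rw [hpow] at h2
  -- numerics: `2^c = 1` or `2^c = 2^12` in `ZMod N` pins `N` to a non-admissible prime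
  simp only [Finset.mem_insert, Finset.mem_singleton] at hc
  rcases h2 with h | h
  · -- `N ∣ 2^c - 1 ∈ {63, 15, 255}`
    have hd : N ∣ 2 ^ c - 1 := dvd_sub_of_natCast_eq Nat.one_le_two_pow (by push_cast; rw [h])
    rcases hc with rfl | rfl | rfl
    · have hmem := Mazur1978.mem_of_prime_dvd_prod hN (l := [3, 3, 7]) (by norm_num) (by norm_num at hd ⊢; exact hd)
      simp only [List.mem_cons, List.not_mem_nil, or_false] at hmem
      omega
    · have hmem := Mazur1978.mem_of_prime_dvd_prod hN (l := [3, 5]) (by norm_num) (by norm_num at hd ⊢; exact hd)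
      simp only [List.mem_cons, List.not_mem_nil, or_false] at hmem
      omega
    · have hmem := Mazur1978.mem_of_prime_dvd_prod hN (l := [3, 5, 17]) (by norm_num) (by norm_num at hd ⊢; exact hd)
      simp only [List.mem_cons, List.not_mem_nil, or_false] at hmem
      omega
  · -- `N ∣ 2^12 - 2^c ∈ {4032, 4080, 3840}`
    have hd : N ∣ 2 ^ 12 - 2 ^ c := dvd_sub_of_natCast_eq
      (Nat.pow_le_pow_right (by norm_num) (by omega)) (by push_cast; rw [h]; norm_num)
    rcases hc with rfl | rfl | rfl
    · have hmem := Mazur1978.mem_of_prime_dvd_prod hN (l := [2, 2, 2, 2, 2, 2, 3, 3, 7]) (by norm_num)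
        (by norm_num at hd ⊢; exact hd)
      simp only [List.mem_cons, List.not_mem_nil, or_false] at hmem
      omega
    · have hmem := Mazur1978.mem_of_prime_dvd_prod hN (l := [2, 2, 2, 2, 3, 5, 17]) (by norm_num)
        (by norm_num at hd ⊢; exact hd)
      simp only [List.mem_cons, List.not_mem_nil, or_false] at hmem
      omega
    · have hmem := Mazur1978.mem_of_prime_dvd_prod hN (l := [2, 2, 2, 2, 2, 2, 2, 2, 3, 5]) (by norm_num)
        (by norm_num at hd ⊢; exact hd)
      simp only [List.mem_cons, List.not_mem_nil, or_false] at hmem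
      omega

/-- **T3 (stub for the prover, size M) — "2-adic Mazur".** A curve with `ord_2 j < 0` and a rational
`N`-isogeny, `N = 11` or `N ≥ 19` prime, has `N = 37`.  Proof plan = the tree's
`Mazur1978.mazur_isogeny_irreducible_of_inputs` verbatim up to the classes of `k` (`h44` at the odd
places, `exists_isogenyCharacter`, `exists_forall_isogenyCharacter_eq_mul_pow`,
`prop51_exponent_classes_of_additive_holds` / `modEq_zero_or_one_of_hasGoodReductionAtPrime`), then:
T1 at an arithmetic Frobenius at `2` + the normal form `r = b·χ̄ᵏ`, `b¹² = 1`, `χ̄(Frob₂) = 2`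
(`Rat.modNCyclotomicCharacter_of_isArithFrobAt`) give `2^{12k} ∈ {1, 2^{12}}`; T2 leaves `k ≡ 0, 1`;
`congruences_of_valuation_j_le_one` at `q = 3, 5` (the `h₂`-formula is symmetric in `k ↔ 1 − k`) and
`caseZero_mem_mazurPrimes` give `N ∈ {2,3,5,7,13,37}`. [cite: Mazur1978, §7 proof of Thm. 7.1 (pp. 154–155)] -/
theorem stubT3 (h44 : Mazur1978.cor44_valuation_j_le_one) (hT1 : TateLineFrobeniusSq) :
    ∀ (W : WeierstrassCurve ℚ) [W.IsElliptic] (N : ℕ) [Fact N.Prime], (N = 11 ∨ 17 ≤ N) → N ≠ 17 →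
      (∃ C : AddSubgroup (geomTorsion W N),
        (∀ σ : absoluteGaloisGroup ℚ, ∀ P ∈ C, σ • P ∈ C) ∧ Nat.card C = N) →
      ∀ v : HeightOneSpectrum (𝓞 ℚ), (2 : 𝓞 ℚ) ∈ v.asIdeal → 1 < v.valuation ℚ W.j → N = 37 := by
  sorry

/-- **T5 (stub for the prover, size M) — the `v = 2` half from T3, rows `17, 37` only, and `hL6`.**
Relativise the landed radius-lite closer (`lite_hexcl`, `mazurKenkuRadius_of_cor44_of_jTables_of_liteLevels6`)
to sources in the isogeny-stable class `{V : ord_2 j(V) < 0}` (`hasMultiplicativeReductionAt_of_isIsogenous`):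
there the table hypothesis for rows `11, 19, 43, 67, 163` holds VACUOUSLY by T3, rows `15, 21, 27` are
tree theorems, row `37` empties the class (`j ∈ {−7·11³, −7·137³·2083³}` is `2`-integral), row `17` is
used as printed; exclusion set `{20,26,32,34,35,42,49,51,65,75,85,125,169,221,273,289}` bounds cyclic
degrees by `144` (`level_budget2.py`). [cite: Kenku1982, Thm. 1] [cite: CremonaAlgorithms1997, §3.8 p. 82] -/
theorem stubT5 (h44 : Mazur1978.cor44_valuation_j_le_one) (hT1 : TateLineFrobeniusSq)
    (hT2rows : ∀ (V V' : WeierstrassCurve ℚ) [V.IsElliptic] [V'.IsElliptic] (ψ : Isogeny V V'),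
      ψ.IsCyclic → ψ.degree ∈ ({17, 37} : Finset ℕ) → (ψ.degree, V.j) ∈ kenkuIsogenyJTable)
    (hL6 : ∀ (V V' : WeierstrassCurve ℚ) [V.IsElliptic] [V'.IsElliptic] (ψ : Isogeny V V'),
      ψ.IsCyclic → ψ.degree ∉ ({26, 35, 49, 65, 125, 169} : Finset ℕ)) :
    Lemma68AtTwo 163 := by
  sorry

/-- **Plan C, assembled (PROVED from the stubs): the verbatim stub from `h44 + hL6 + rows {17,37} + T1`.** -/
theorem stub_of_planC (h44 : Mazur1978.cor44_valuation_j_le_one) (hT1 : TateLineFrobeniusSq)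
    (hT2rows : ∀ (V V' : WeierstrassCurve ℚ) [V.IsElliptic] [V'.IsElliptic] (ψ : Isogeny V V'),
      ψ.IsCyclic → ψ.degree ∈ ({17, 37} : Finset ℕ) → (ψ.degree, V.j) ∈ kenkuIsogenyJTable)
    (hL6 : ∀ (V V' : WeierstrassCurve ℚ) [V.IsElliptic] [V'.IsElliptic] (ψ : Isogeny V V'),
      ψ.IsCyclic → ψ.degree ∉ ({26, 35, 49, 65, 125, 169} : Finset ℕ)) :
    PastenShimura2024_lemma_6_8 :=
  stub_of_split (lemma68Odd_of_cor44_of_liteLevels6 h44 hL6) (stubT5 h44 hT1 hT2rows hL6)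

end Summit.ABC.ABC.Cruxes.DefiniteRTControlPrime.StubIdeas3G14

end
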